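import Summits.Ventures.PercRepro.C026ProdCFMono

/-!
# THEOREM R: CONJECTURE EM ⟹ CONJECTURE MONO ⟹ C-026's (CF) form (p5, gen 17)

mine-3's CONJECTURE EM (INBOX 6152, `proofs/MINE3-EDGEMONO.md` §2): «deleting an OFF-MARK edge —
neither end is `a` or `b` — never increases the C-026 slack», `Δ_CF(H − e) ≤ Δ_CF(H)`. THEOREM R
(§4) reduces the crux to it: (R1) EM ⟹ MONO (ROW C-031, the tree's `Mono`) and (R2) EM ⟹ (CF).
Both are typed here over the landed `Mono` vocabulary, with mine-3's (R0) — the hub factor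
`Δ_CF(H) = (2^k + 2^l − 1)·Δ_CF(H − u)` when every edge at the non-mark `u` goes to `a` or `b` —
abstracted into the hypothesis `HubFactor` (p6's `slackCF_eq_of_hubAB`, C026HubParallelAny,
discharges it in C026EdgeMonoMain).

* `delEdgeSide e₀` — deleting the edge `e₀`: the side `true` keeps every other edge
  (`H − e₀ = H.part (delEdgeSide e₀) true`, the edge twin of `delSide`);
* `EdgeMono a b c` — CONJECTURE EM, quantified over every finite edge type of the universe of `E`;
* `HubFactor a b c` — (R0) in hypothesis form with the factor abstracted: `Δ_CF(H) = m·Δ_CF(H − u)`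
  for some integer `m ≥ 1`;
* `slackCF_self` — `Δ_CF` vanishes when the marks `a`, `b` coincide (the degenerate case);
* `slackCF_part_le_of_edgeMono` — EM for a SET of off-mark edges (induction on the number deleted,
  one relabelling per step, `slackCF_relabel`);
* **`slackCF_nonneg_of_edgeMono_of_hubFactor`** — (R2): strong induction on the edge-carrying
  non-marks exactly as in `slackCF_nonneg_of_mono`; at a non-mark `u` adjacent to `a` or `b`, strip
  `u`'s off-mark edges (EM), apply (R0) at `u`, and use the induction hypothesis on `H − u`;
* **`slackCF_del_le_of_edgeMono_of_hubFactor`**, **`mono_of_edgeMono_of_hubFactor`** — (R1):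
  `Δ_CF(H) ≥ Δ_CF(H′) = m·Δ_CF(H − u) ≥ Δ_CF(H − u)` once `0 ≤ Δ_CF(H − u)` by (R2) — for EVERY
  non-mark `u ≠ c`, adjacent to a mark or not;
* `edgeMono_iff_addEdge` — EM in the `addEdge` vocabulary of DC-SUB (`slackCF_addEdge`):
  `Δ_CF(G) ≤ Δ_CF(G + uv)` for every off-mark pair `u, v`.
The route differs from mine-3's (R2) (strip ALL off-mark edges, evaluate the pure-hub graph): the
reduction is the `Mono` induction with (R0) at the hub, so no product formula is needed. -/

universe u v

namespace PercRepro

open Finset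

namespace MultiGraph

section EdgeMono

variable {V : Type u}

open Classical in
/-- Deleting the edge `e₀`: the side `true` keeps every other edge
(`H − e₀ = H.part (delEdgeSide e₀) true`). -/
noncomputable def delEdgeSide {E : Type v} (e₀ : E) : E → Bool := fun e => decide (e ≠ e₀)

open Classical in
/-- The side `true` of `delEdgeSide e₀` is every edge other than `e₀`. -/
theorem delEdgeSide_eq_true_iff {E : Type v} (e₀ e : E) : delEdgeSide e₀ e = true ↔ e ≠ e₀ := by
  unfold delEdgeSide
  exact decide_eq_true_iff

open Classical in
/-- **CONJECTURE EM** (mine-3, INBOX 6152): deleting an OFF-MARK edge `e` — neither end is `a` or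
`b` — never increases `Δ_CF`, for every marked multigraph on `V` with a finite edge type of the
universe `v`. -/
def EdgeMono (a b c : V) : Prop :=
  ∀ (E : Type v) [Fintype E] (H : MultiGraph V E) (e : E), ¬ H.EdgeAt e a → ¬ H.EdgeAt e b →
    (H.part (delEdgeSide e) true).slackCF a b c ≤ H.slackCF a b c

open Classical in
/-- **The hub factor** — mine-3's (R0) in hypothesis form with the factor abstracted: whenever
every edge at the non-mark `u` joins `u` to `a` or to `b`, `Δ_CF(H) = m·Δ_CF(H − u)` for some
integer `m ≥ 1` (p6's `slackCF_eq_of_hubAB` gives `m = 2^k + 2^l − 1`). -/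
def HubFactor (a b c : V) : Prop :=
  ∀ (E : Type v) [Fintype E] (H : MultiGraph V E) (u : V), u ≠ a → u ≠ b → u ≠ c →
    (∀ e, H.EdgeAt e u → H.EdgeAt e a ∨ H.EdgeAt e b) →
    ∃ m : ℤ, 1 ≤ m ∧ H.slackCF a b c = m * (H.part (H.delSide u) true).slackCF a b c

open Classical in
/-- `Δ_CF` vanishes when the two marks `a`, `b` coincide: `ω ↦ ωᶜ` matches `{a ≁ c}` with
`{c ≁ a}` read in the closed edges, and the two remaining cells are empty. -/
theorem slackCF_self {E : Type v} [Fintype E] (G : MultiGraph V E) (a c : V) :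
    G.slackCF a a c = 0 := by
  unfold slackCF
  have h2 : (univ.filter fun ω : Config E => G.Conn ω c a ∧ ¬ G.Conn ω c a) = ∅ := by
    ext ω
    simp
  have h1 : (univ.filter fun ω : Config E => G.Conn ω a a ∧ ¬ G.Conn ω a c).card =
      (univ.filter fun ω : Config E =>
        G.Conn ω a a ∧ ¬ G.Conn ωᶜ c a ∧ ¬ G.Conn ωᶜ c a).card := by
    refine Finset.card_bij (fun ω _ => ωᶜ) ?_ ?_ ?_
    · intro ω hω
      simp only [Finset.mem_filter, Finset.mem_univ, true_and] at hω ⊢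
      rw [compl_compl]
      exact ⟨Conn.refl G _ a, fun h => hω.2 h.symm, fun h => hω.2 h.symm⟩
    · intro ω _ ω' _ h
      exact compl_injective h
    · intro ω hω
      refine ⟨ωᶜ, ?_, compl_compl ω⟩
      simp only [Finset.mem_filter, Finset.mem_univ, true_and] at hω ⊢
      exact ⟨Conn.refl G _ a, fun h => hω.2.1 h.symm⟩
  rw [h2, h1]
  simp

/-! ### Relabellings: a part keeping everything; putting one edge back -/

/-- A part keeping every edge is a relabelling of the graph. -/
theorem isRelabel_part_of_forall {E : Type v} (H : MultiGraph V E) (keep : E → Bool)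
    (h : ∀ e, keep e = true) :
    IsRelabel (H.part keep true) H (Equiv.subtypeUnivEquiv h) :=
  fun _ => ⟨rfl, rfl⟩

open Classical in
/-- `keep` with the edge `e₀` put back. -/
noncomputable def keepInsert {E : Type v} (keep : E → Bool) (e₀ : E) : E → Bool :=
  fun e => keep e || decide (e = e₀)

/-- `keepInsert keep e₀` keeps `e₀`. -/
theorem keepInsert_self {E : Type v} (keep : E → Bool) (e₀ : E) :
    keepInsert keep e₀ e₀ = true := by
  unfold keepInsert
  simp

/-- `keepInsert keep e₀` drops exactly the edges dropped by `keep` other than `e₀`. -/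
theorem keepInsert_eq_false_iff {E : Type v} (keep : E → Bool) (e₀ e : E) :
    keepInsert keep e₀ e = false ↔ keep e = false ∧ e ≠ e₀ := by
  unfold keepInsert
  simp

open Classical in
/-- The edges of `(H with `e₀` put back) − e₀` are the edges of `H.part keep true`. -/
noncomputable def delEdgeEquiv {E : Type v} (keep : E → Bool) {e₀ : E} (h₀ : keep e₀ = false) :
    {x : {e // keepInsert keep e₀ e = true} //
      delEdgeSide (⟨e₀, keepInsert_self keep e₀⟩ : {e // keepInsert keep e₀ e = true}) x = true} ≃
      {e // keep e = true} where
  toFun x := ⟨x.1.1, by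
    have h1 : keep x.1.1 = true ∨ x.1.1 = e₀ := by
      have h := x.1.2
      unfold keepInsert at h
      simpa using h
    have h2 : x.1.1 ≠ e₀ := fun h => (delEdgeSide_eq_true_iff _ _).1 x.2 (Subtype.ext h)
    exact h1.resolve_right h2⟩
  invFun y := ⟨⟨y.1, by
      unfold keepInsert
      simp [y.2]⟩, by
      refine (delEdgeSide_eq_true_iff _ _).2 fun h => ?_
      have h' : y.1 = e₀ := congrArg Subtype.val h
      have := y.2
      rw [h', h₀] at this
      exact Bool.false_ne_true this⟩
  left_inv x := Subtype.ext (Subtype.ext rfl)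
  right_inv y := Subtype.ext rfl

open Classical in
/-- Putting `e₀` back and deleting it again is a relabelling of `H.part keep true`. -/
theorem isRelabel_delEdge {E : Type v} (H : MultiGraph V E) (keep : E → Bool) {e₀ : E}
    (h₀ : keep e₀ = false) :
    IsRelabel ((H.part (keepInsert keep e₀) true).part
        (delEdgeSide (⟨e₀, keepInsert_self keep e₀⟩ : {e // keepInsert keep e₀ e = true})) true)
      (H.part keep true) (delEdgeEquiv keep h₀) :=
  fun _ => ⟨rfl, rfl⟩

/-! ### EM for a set of off-mark edges -/

open Classical in
/-- **EM for a set of edges**: under CONJECTURE EM, deleting any set of off-mark edges never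
increases `Δ_CF` (induction on the number of deleted edges, putting them back one at a time). -/
theorem slackCF_part_le_of_edgeMono {a b c : V} (hE : EdgeMono.{u, v} a b c) {E : Type v}
    [Fintype E] (H : MultiGraph V E) (keep : E → Bool)
    (hoff : ∀ e, keep e = false → ¬ H.EdgeAt e a ∧ ¬ H.EdgeAt e b) :
    (H.part keep true).slackCF a b c ≤ H.slackCF a b c := by
  suffices h : ∀ n : ℕ, ∀ keep : E → Bool, (univ.filter fun e => keep e = false).card = n →
      (∀ e, keep e = false → ¬ H.EdgeAt e a ∧ ¬ H.EdgeAt e b) →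
      (H.part keep true).slackCF a b c ≤ H.slackCF a b c from h _ keep rfl hoff
  intro n
  induction n with
  | zero =>
    intro keep hn _
    have hall : ∀ e, keep e = true := by
      intro e
      by_contra h
      have hmem : e ∈ univ.filter fun e => keep e = false := by
        simp only [Finset.mem_filter, Finset.mem_univ, true_and]
        exact Bool.eq_false_iff.mpr h
      rw [Finset.card_eq_zero] at hn
      rw [hn] at hmem
      exact Finset.notMem_empty e hmem
    rw [slackCF_relabel (isRelabel_part_of_forall H keep hall)]
  | succ n ih =>
    intro keep hn hoff
    obtain ⟨e₀, he₀⟩ : ∃ e, keep e = false := by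
      obtain ⟨e, he⟩ := Finset.card_pos.1 (by omega : 0 < (univ.filter fun e => keep e = false).card)
      exact ⟨e, (Finset.mem_filter.1 he).2⟩
    have hn' : (univ.filter fun e => keepInsert keep e₀ e = false).card = n := by
      have hset : (univ.filter fun e => keepInsert keep e₀ e = false) =
          (univ.filter fun e => keep e = false).erase e₀ := by
        ext e
        simp only [Finset.mem_filter, Finset.mem_univ, true_and, Finset.mem_erase,
          keepInsert_eq_false_iff]
        tauto
      rw [hset, Finset.card_erase_of_mem (by simpa using he₀), hn]
      rfl
    have hoff' : ∀ e, keepInsert keep e₀ e = false → ¬ H.EdgeAt e a ∧ ¬ H.EdgeAt e b :=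
      fun e he => hoff e ((keepInsert_eq_false_iff keep e₀ e).1 he).1
    have h1 := ih _ hn' hoff'
    have h2 := hE _ (H.part (keepInsert keep e₀) true) ⟨e₀, keepInsert_self keep e₀⟩
      (hoff e₀ he₀).1 (hoff e₀ he₀).2
    rw [slackCF_relabel (isRelabel_delEdge H keep he₀)] at h2
    exact h2.trans h1

/-! ### Stripping the off-mark edges at a vertex -/

open Classical in
/-- Keeping every edge except the off-mark edges at `u`. -/
noncomputable def keepHub {E : Type v} (H : MultiGraph V E) (u a b : V) : E → Bool :=
  fun e => decide (H.EdgeAt e u → H.EdgeAt e a ∨ H.EdgeAt e b)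

/-- `keepHub` drops exactly the off-mark edges at `u`. -/
theorem keepHub_eq_false_iff {E : Type v} (H : MultiGraph V E) (u a b : V) (e : E) :
    H.keepHub u a b e = false ↔ H.EdgeAt e u ∧ ¬ H.EdgeAt e a ∧ ¬ H.EdgeAt e b := by
  unfold keepHub
  simp [not_or]

open Classical in
/-- After the stripping, every edge at `u` goes to `a` or to `b`. -/
theorem part_keepHub_hub {E : Type v} (H : MultiGraph V E) (u a b : V) :
    ∀ e, (H.part (H.keepHub u a b) true).EdgeAt e u →
      (H.part (H.keepHub u a b) true).EdgeAt e a ∨ (H.part (H.keepHub u a b) true).EdgeAt e b := by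
  intro e he
  have h := e.2
  unfold keepHub at h
  rw [decide_eq_true_iff] at h
  exact h he

open Classical in
/-- The edges not at `u` of the stripped graph are the edges not at `u` of `H`. -/
noncomputable def hubDelEquiv {E : Type v} (H : MultiGraph V E) (u a b : V) :
    {x : {e // H.keepHub u a b e = true} // (H.part (H.keepHub u a b) true).delSide u x = true} ≃
      {e // H.delSide u e = true} where
  toFun x := ⟨x.1.1, by
    have h := x.2
    unfold delSide at h ⊢
    rw [decide_eq_true_iff] at h ⊢
    exact h⟩
  invFun y := ⟨⟨y.1, by
      have h := y.2
      unfold delSide at h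
      rw [decide_eq_true_iff] at h
      unfold keepHub
      rw [decide_eq_true_iff]
      intro h'
      exact absurd h' h⟩, by
      have h := y.2
      unfold delSide at h ⊢
      rw [decide_eq_true_iff] at h ⊢
      exact h⟩
  left_inv x := Subtype.ext (Subtype.ext rfl)
  right_inv y := Subtype.ext rfl

open Classical in
/-- Deleting `u` from the stripped graph is a relabelling of `H − u`. -/
theorem isRelabel_hubDel {E : Type v} (H : MultiGraph V E) (u a b : V) :
    IsRelabel ((H.part (H.keepHub u a b) true).part ((H.part (H.keepHub u a b) true).delSide u) true)
      (H.part (H.delSide u) true) (hubDelEquiv H u a b) :=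
  fun _ => ⟨rfl, rfl⟩

open Classical in
/-- The stripped graph `H′` satisfies `Δ_CF(H′) ≤ Δ_CF(H)` (EM) and `Δ_CF(H′) = m·Δ_CF(H − u)`
with `m ≥ 1` ((R0)). -/
theorem slackCF_keepHub {a b c : V} (hF : HubFactor.{u, v} a b c) (hE : EdgeMono.{u, v} a b c)
    {E : Type v} [Fintype E] (H : MultiGraph V E) {u : V} (hua : u ≠ a) (hub : u ≠ b)
    (huc : u ≠ c) :
    (H.part (H.keepHub u a b) true).slackCF a b c ≤ H.slackCF a b c ∧
      ∃ m : ℤ, 1 ≤ m ∧ (H.part (H.keepHub u a b) true).slackCF a b c =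
        m * (H.part (H.delSide u) true).slackCF a b c := by
  refine ⟨slackCF_part_le_of_edgeMono hE H _
    (fun e he => ((keepHub_eq_false_iff H u a b e).1 he).2), ?_⟩
  obtain ⟨m, hm1, hm⟩ := hF _ (H.part (H.keepHub u a b) true) u hua hub huc (part_keepHub_hub H u a b)
  rw [slackCF_relabel (isRelabel_hubDel H u a b)] at hm
  exact ⟨m, hm1, hm⟩

/-! ### THEOREM R -/

open Classical in
/-- The induction of (R2): EM + the hub factor give (CF) for every marked multigraph with `m`
edge-carrying non-marks (the induction of `slackCF_nonneg_of_mono`, with the MONO step replaced by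
«strip `u`'s off-mark edges, then (R0) at `u`»). -/
theorem slackCF_nonneg_of_edgeMono_aux {a b c : V} (hF : HubFactor.{u, v} a b c)
    (hE : EdgeMono.{u, v} a b c) (m : ℕ) :
    ∀ (E : Type v) [Fintype E] (G : MultiGraph V E), (G.nonMarkSupp a b c).card = m →
      0 ≤ G.slackCF a b c := by
  induction m using Nat.strong_induction_on with
  | _ m ih =>
    intro E _ G hm
    by_cases hu : ∃ u, u ≠ a ∧ u ≠ b ∧ u ≠ c ∧ ∃ e, G.EdgeAt e u ∧ (G.EdgeAt e a ∨ G.EdgeAt e b)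
    · -- strip `u`'s off-mark edges, apply (R0) at `u`, and use the induction hypothesis on `G − u`
      obtain ⟨u, hua, hub, huc, e, heu, hea⟩ := hu
      have hmem : u ∈ G.nonMarkSupp a b c :=
        Finset.mem_filter.mpr ⟨(mem_supp G u).mpr ⟨e, heu⟩, hua, hub, huc⟩
      have hlt := card_nonMarkSupp_del_lt G (a := a) (b := b) (c := c) hmem
      rw [hm] at hlt
      have h1 : 0 ≤ (G.part (G.delSide u) true).slackCF a b c :=
        ih _ hlt _ (G.part (G.delSide u) true) rfl
      obtain ⟨h2, k, hk1, hk⟩ := slackCF_keepHub hF hE G hua hub huc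
      refine le_trans ?_ h2
      rw [hk]
      exact mul_nonneg (by linarith) h1
    · -- no non-mark is adjacent to `a` or `b`: every component core has `a` isolated
      push Not at hu
      refine slackCF_nonneg_of_components a b c fun κ _ => ?_
      refine slackCF_nonneg_of_isolated (Or.inl fun e' he' => ?_)
      have he'a : G.EdgeAt e'.1 a := he'
      rcases nonMark_end_of_compColour_inl e'.2 with hw | hw
      · simp only [Set.mem_insert_iff, Set.mem_singleton_iff, not_or] at hw
        exact (hu (G.fst e'.1) hw.1 hw.2.1 hw.2.2 e'.1 (Or.inl rfl)).1 he'a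
      · simp only [Set.mem_insert_iff, Set.mem_singleton_iff, not_or] at hw
        exact (hu (G.snd e'.1) hw.1 hw.2.1 hw.2.2 e'.1 (Or.inr rfl)).1 he'a

/-- **THEOREM R (R2), modulo the hub factor**: CONJECTURE EM gives `0 ≤ Δ_CF` on every marked
multigraph on `V` with marks `a, b, c`. -/
theorem slackCF_nonneg_of_edgeMono_of_hubFactor {a b c : V} (hF : HubFactor.{u, v} a b c)
    (hE : EdgeMono.{u, v} a b c) {E : Type v} [Fintype E] (G : MultiGraph V E) :
    0 ≤ G.slackCF a b c :=
  slackCF_nonneg_of_edgeMono_aux hF hE _ E G rfl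

open Classical in
/-- **THEOREM R (R1), modulo the hub factor, for every non-mark**: under CONJECTURE EM, deleting
ANY vertex `u ∉ {a, b, c}` never increases `Δ_CF` — adjacent to a mark or not:
`Δ_CF(H − u) ≤ m·Δ_CF(H − u) = Δ_CF(H′) ≤ Δ_CF(H)` with `H′` the stripped graph. -/
theorem slackCF_del_le_of_edgeMono_of_hubFactor {a b c : V} (hF : HubFactor.{u, v} a b c)
    (hE : EdgeMono.{u, v} a b c) {E : Type v} [Fintype E] (H : MultiGraph V E) {u : V}
    (hua : u ≠ a) (hub : u ≠ b) (huc : u ≠ c) :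
    (H.part (H.delSide u) true).slackCF a b c ≤ H.slackCF a b c := by
  have h1 : 0 ≤ (H.part (H.delSide u) true).slackCF a b c :=
    slackCF_nonneg_of_edgeMono_of_hubFactor hF hE _
  obtain ⟨h2, k, hk1, hk⟩ := slackCF_keepHub hF hE H hua hub huc
  calc (H.part (H.delSide u) true).slackCF a b c
      = 1 * (H.part (H.delSide u) true).slackCF a b c := (one_mul _).symm
    _ ≤ k * (H.part (H.delSide u) true).slackCF a b c := mul_le_mul_of_nonneg_right hk1 h1
    _ = (H.part (H.keepHub u a b) true).slackCF a b c := hk.symm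
    _ ≤ H.slackCF a b c := h2

/-- **THEOREM R (R1), modulo the hub factor**: CONJECTURE EM implies CONJECTURE MONO
(ROW C-031). -/
theorem mono_of_edgeMono_of_hubFactor {a b c : V} (hF : HubFactor.{u, v} a b c)
    (hE : EdgeMono.{u, v} a b c) : Mono.{u, v} a b c :=
  fun _ _ H _ hua hub huc _ => slackCF_del_le_of_edgeMono_of_hubFactor hF hE H hua hub huc

/-! ### EM in the `addEdge` vocabulary of DC-SUB -/

open Classical in
/-- The edges of `H` are those of `H − e₀` together with `e₀`. -/
noncomputable def delEdgeOptionEquiv {E : Type v} (e₀ : E) :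
    Option {e // delEdgeSide e₀ e = true} ≃ E :=
  (Equiv.optionCongr (Equiv.subtypeEquivRight fun e => delEdgeSide_eq_true_iff e₀ e)).trans
    (Equiv.optionSubtypeNe e₀)

open Classical in
/-- `(H − e₀) + e₀` is a relabelling of `H`. -/
theorem isRelabel_addEdge_delEdge {E : Type v} (H : MultiGraph V E) (e₀ : E) :
    IsRelabel ((H.part (delEdgeSide e₀) true).addEdge (H.fst e₀) (H.snd e₀)) H
      (delEdgeOptionEquiv e₀) := by
  rintro (_ | x)
  · exact ⟨rfl, rfl⟩
  · exact ⟨rfl, rfl⟩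

open Classical in
/-- The edges of `(G + uv) − uv` are the edges of `G`. -/
noncomputable def addEdgeDelEquiv (E : Type v) :
    {x : Option E // delEdgeSide (none : Option E) x = true} ≃ E :=
  (Equiv.subtypeEquivRight fun x => by
    rw [delEdgeSide_eq_true_iff]
    exact Option.ne_none_iff_isSome).trans (Equiv.optionIsSomeEquiv E)

open Classical in
/-- `(G + uv) − uv` is a relabelling of `G`. -/
theorem isRelabel_delEdge_addEdge {E : Type v} (G : MultiGraph V E) (u v : V) :
    IsRelabel ((G.addEdge u v).part (delEdgeSide (none : Option E)) true) G (addEdgeDelEquiv E) := by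
  rintro ⟨_ | e, hx⟩
  · exact absurd rfl ((delEdgeSide_eq_true_iff _ _).1 hx)
  · exact ⟨rfl, rfl⟩

open Classical in
/-- **EM in the `addEdge` vocabulary** (the language of DC-SUB, `slackCF_addEdge`): CONJECTURE EM
holds iff adding an edge between two vertices other than `a`, `b` never decreases `Δ_CF`. -/
theorem edgeMono_iff_addEdge (a b c : V) :
    EdgeMono.{u, v} a b c ↔
      ∀ (E : Type v) [Fintype E] (G : MultiGraph V E) (u v : V), u ≠ a → u ≠ b → v ≠ a → v ≠ b →
        G.slackCF a b c ≤ (G.addEdge u v).slackCF a b c := by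
  constructor
  · intro hE E _ G u v hua hub hva hvb
    have h := hE _ (G.addEdge u v) none (fun h => h.elim hua hva) (fun h => h.elim hub hvb)
    rwa [slackCF_relabel (isRelabel_delEdge_addEdge G u v)] at h
  · intro h E _ H e hea heb
    have h' := h _ (H.part (delEdgeSide e) true) (H.fst e) (H.snd e)
      (fun h' => hea (Or.inl h')) (fun h' => heb (Or.inl h')) (fun h' => hea (Or.inr h'))
      (fun h' => heb (Or.inr h'))
    rwa [slackCF_relabel (isRelabel_addEdge_delEdge H e)] at h'

end EdgeMono

end MultiGraph

end PercRepro
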